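import Summits.AnomalousDissipation.AnomalousDissipation.Theorems.CoherentFractionBoundedQuietPlanarity.Negative.WindyRootsPower
import Summits.AnomalousDissipation.AnomalousDissipation.Theorems.CoherentFractionInvariantExtremeClimatesPlanar.Negative.OrbitStates
import HarnessLib

/-!
# The whole space–time orbit of an inviscid root is invisible to viscous climates
# (negative lane of `CoherentFraction.BoundedQuietPlanarity`, stmt-AnomalousDissipation-33307 — addendum 2)

`BoundedNonPlanarCoherentStates` (33798) asks for TIME-PERIODIC global Leray–Hopf solutions of
`NS_ν(f_K)`, and `BoundedQuietPlanarity` (33307) / `TameQuietPlanarity` (27440) quantify over arbitrary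
(time-dependent) ones.  The inviscid root family offers time-dependent candidates as well: transport a
root `W` along any horizontal path `a(s)` (the force `f_K = sin(4πx₁)e₀` is invariant under horizontal
translations) and add any wind `m'(s)` — `u(s, x) = m'(s) + W(x + a(s))`; for `a(s) = s c`, `m'` constant,
these are the Galilean travelling waves of the windy steady Euler solutions, and periodic `a, m'` give
time-periodic fields of bounded energy and positive planar-symmetry defect, i.e. exactly the FORMAT of a
33798 witness.  None of them is Leray–Hopf at any `ν > 0` (`galileanRoot_not_isGlobalLerayHopf`): along
such a trajectory the injected power vanishes at EVERY time (`(f, m'(s)) = 0`, and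
`(f, W(· + a(s))) = (f, W) = 0` by the invariance of `f` and of Haar measure, roots being powerless),
while the enstrophy is constantly `‖∇W‖₂²` (translations and winds do not change it), so the tree's
Doering–Foias bound `⟨ν‖∇u‖₂²⟩ ≤ ⟨(f, u)⟩` reads `ν‖∇W‖₂² ≤ 0`, whence `W = 0` by Poincaré.  Instance:
`galilean_vfieldT_not_isGlobalLerayHopf` — for the crossed-shear roots `v_t` (`t ≠ 0`), every wind
`m' : ℝ → ℝ³` and every horizontal path `σ : ℝ → 𝕋²`, the field `(s, x) ↦ m'(s) + v_t(x + (σ₀(s), 0, σ₁(s)))`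
is a global Leray–Hopf solution of `NS_ν(f_K)` for no `ν > 0` and no datum.
[folklore; Doering–Foias 2002 §2 for the power bound]
-/

noncomputable section

-- `Summit.<Summit>.<Problem>` is the tree's mandated summit-side namespace (CONVENTIONS §2); for this
-- single-conjunct summit the two segments coincide, so the duplicate is deliberate.
set_option linter.dupNamespace false

namespace Summit.AnomalousDissipation.AnomalousDissipation.Theorems.CrossedShearRoot

open Real MeasureTheory Filter
open scoped InnerProductSpace ENNReal
open Literature.Analysis.FunctionSpaces Literature.Analysis.FunctionSpaces.Torus Literature.Analysis.FluidPDE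

/-- **Power slices vanish along the transported orbit.** For smooth mean-zero `f` invariant under the
translations `a(s)`, a wind `m'(s)` and a powerless field `W` (`(f, W) = 0`):
`(f, m'(s) + W(· + a(s))) = 0` for every `s`. [folklore] -/
theorem integral_inner_wind_add_translate_eq_zero {f W : UnitAddTorus (Fin 3) → EuclideanSpace ℝ (Fin 3)}
    (hfs : IsSmooth f) (hf0 : HasZeroMean f) (hWs : IsSmooth W) (hPW : ∫ x, ⟪f x, W x⟫_ℝ = 0)
    (m' : ℝ → EuclideanSpace ℝ (Fin 3)) (a : ℝ → UnitAddTorus (Fin 3)) (hfa : ∀ s x, f (x + a s) = f x)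
    (s : ℝ) : ∫ x, ⟪f x, m' s + W (x + a s)⟫_ℝ = 0 := by
  have i1 : Integrable (fun x => ⟪f x, m' s⟫_ℝ) volume := hfs.integrable.inner_const _
  have i2 : Integrable (fun x => ⟪f x, W (x + a s)⟫_ℝ) volume :=
    (hfs.inner (hWs.comp_add_right (a s))).integrable
  have hsplit : ∫ x, ⟪f x, m' s + W (x + a s)⟫_ℝ = (∫ x, ⟪f x, m' s⟫_ℝ) + ∫ x, ⟪f x, W (x + a s)⟫_ℝ := by
    rw [← integral_add i1 i2]
    exact integral_congr_ae (ae_of_all _ fun x => inner_add_right _ _ _)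
  have htr : ∫ x, ⟪f x, W (x + a s)⟫_ℝ = ∫ x, ⟪f x, W x⟫_ℝ := by
    have h1 : (fun x => ⟪f x, W (x + a s)⟫_ℝ) = fun x => (fun y => ⟪f y, W y⟫_ℝ) (x + a s) := by
      funext x
      show ⟪f x, W (x + a s)⟫_ℝ = ⟪f (x + a s), W (x + a s)⟫_ℝ
      rw [hfa s x]
    rw [h1, integral_add_right_eq_self (fun y => ⟪f y, W y⟫_ℝ) (a s)]
  rw [hsplit, integral_inner_const_eq_zero hfs.integrable hf0, htr, hPW, add_zero]

/-- **Enstrophy is constant along the transported orbit**: `‖∇(m' + W(· + a))‖₂² = ‖∇W‖₂²`. [folklore] -/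
theorem eGradNormSq_wind_add_translate (m' : EuclideanSpace ℝ (Fin 3)) (a : UnitAddTorus (Fin 3))
    {W : UnitAddTorus (Fin 3) → EuclideanSpace ℝ (Fin 3)} (hW : Integrable W volume) :
    eGradNormSq (fun x => m' + W (x + a)) = eGradNormSq W := by
  have hfun : (fun x => m' + W (x + a)) = fun y => W (y + a) - (-m') := by
    funext y; rw [sub_neg_eq_add, add_comm]
  rw [hfun]
  exact Literature.Analysis.FluidPDE.Torus.eGradNormSq_comp_add_right_sub_const hW a (-m')

/-- **THE SPACE–TIME ORBIT OF AN INVISCID ROOT IS INVISIBLE TO VISCOUS CLIMATES.** Let `W ≠ 0` be a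
smooth mean-zero divergence-free classical root of `(W·∇)W + DW·m + ∇q = f` (`f` smooth, mean zero),
`a : ℝ → 𝕋³` any path of `f`-preserving translations (`f(x + a(s)) = f(x)`) and `m' : ℝ → ℝ³` any wind.
Then `u(s, x) = m'(s) + W(x + a(s))` — travelling waves, time-periodic transports, windy steady states —
is a global Leray–Hopf solution of `NS_ν(f)` for NO `ν > 0` and no datum: its power vanishes at every
time and its enstrophy is constantly `‖∇W‖₂²`, so `⟨ν‖∇u‖²⟩ ≤ ⟨(f,u)⟩` would give `ν‖∇W‖₂² ≤ 0`, `W = 0`.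
[folklore] -/
theorem galileanRoot_not_isGlobalLerayHopf {f W : UnitAddTorus (Fin 3) → EuclideanSpace ℝ (Fin 3)}
    {q : UnitAddTorus (Fin 3) → ℝ} {m : EuclideanSpace ℝ (Fin 3)} (hfs : IsSmooth f) (hf0 : HasZeroMean f)
    (hWs : IsSmooth W) (hdiv : IsDivFree W) (hzm : HasZeroMean W) (hq : IsSmooth q)
    (hroot : ∀ x, Torus.convect W W x + Torus.fderiv W x m + Torus.gradient q x = f x) (hW0 : W ≠ 0)
    (m' : ℝ → EuclideanSpace ℝ (Fin 3)) (a : ℝ → UnitAddTorus (Fin 3)) (hfa : ∀ s x, f (x + a s) = f x)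
    {ν : ℝ} (hν : 0 < ν) (u₀ : UnitAddTorus (Fin 3) → EuclideanSpace ℝ (Fin 3)) :
    ¬ Torus.IsGlobalLerayHopf ν (fun _ => f) u₀ (fun s x => m' s + W (x + a s)) := by
  intro hLH
  have hDF := DoeringFoias2002_dissipation_le_power_holds hν (hfs.memLp 2) hf0 u₀ _ hLH
  have hPW : ∫ x, ⟪f x, W x⟫_ℝ = 0 := integral_inner_eq_zero_of_eulerDriftRoot hWs hdiv hq m hroot
  -- the mean power vanishes
  have hP : meanPower f (fun s x => m' s + W (x + a s)) = 0 := by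
    have hfun : (fun s => ∫ x, ⟪f x, m' s + W (x + a s)⟫_ℝ) = fun _ => (0 : ℝ) :=
      funext (integral_inner_wind_add_translate_eq_zero hfs hf0 hWs hPW m' a hfa)
    show longTimeAvgSup (fun s => ∫ x, ⟪f x, m' s + W (x + a s)⟫_ℝ) = 0
    rw [hfun]
    simp only [longTimeAvgSup, timeMean_zero_fun, limsup_const]
  -- the mean dissipation is `ν‖∇W‖₂²`
  have hD : meanDissipation ν (fun s x => m' s + W (x + a s)) = ν * (eGradNormSq W).toReal := by
    have h := meanDissipation_of_const ν W
    have hfun : (fun s => ν * (eGradNormSq (fun x => m' s + W (x + a s))).toReal) =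
        fun _ => ν * (eGradNormSq W).toReal :=
      funext fun s => by rw [eGradNormSq_wind_add_translate (m' s) (a s) hWs.integrable]
    show longTimeAvgSup (fun s => ν * (eGradNormSq (fun x => m' s + W (x + a s))).toReal) = _
    rw [hfun]
    exact h
  rw [hD, hP] at hDF
  have hfin : eGradNormSq W < ⊤ := eGradNormSq_lt_top hWs
  have h2 : (eGradNormSq W).toReal = 0 := by
    have h0 : 0 ≤ (eGradNormSq W).toReal := ENNReal.toReal_nonneg
    nlinarith
  rcases (ENNReal.toReal_eq_zero_iff _).1 h2 with h | h
  · exact hW0 (eq_zero_of_eGradNormSq_eq_zero hWs hdiv hzm h)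
  · exact absurd h hfin.ne

variable {t : ℝ}

/-- **No space–time transport of a crossed-shear root is a viscous solution.** For `t ≠ 0`, every wind
`m' : ℝ → ℝ³`, every horizontal path `σ : ℝ → 𝕋²` (`hvec σ = (σ₀, 0, σ₁)`), every `ν > 0` and datum `u₀`:
`(s, x) ↦ m'(s) + v_t(x + hvec σ(s))` is NOT a global Leray–Hopf solution of `NS_ν(f_K)` — this covers
the steady (`σ, m'` constant), windy (`m' = t c_K e₁`), travelling-wave (`σ(s) = s c`) and time-periodic
(`σ, m'` periodic) members of the family: none can witness `BoundedNonPlanarCoherentStates` 33798 or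
refute `BoundedQuietPlanarity` 33307 / `TameQuietPlanarity` 27440. [folklore] -/
theorem galilean_vfieldT_not_isGlobalLerayHopf (ht : t ≠ 0) {ν : ℝ} (hν : 0 < ν)
    (m' : ℝ → EuclideanSpace ℝ (Fin 3)) (σ : ℝ → UnitAddTorus (Fin 2))
    (u₀ : UnitAddTorus (Fin 3) → EuclideanSpace ℝ (Fin 3)) :
    ¬ Torus.IsGlobalLerayHopf ν (fun _ => fK) u₀ (fun s x => m' s + vfieldT t (x + CrossedShearOrbit.hvec (σ s))) :=
  galileanRoot_not_isGlobalLerayHopf isSmooth_fK hasZeroMean_fK (isSmooth_vfieldT t) (isDivFree_vfieldT t)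
    (hasZeroMean_vfieldT t) isSmooth_pres (crossedShear_momentumT ht) (vfieldT_ne_zero ht) m'
    (fun s => CrossedShearOrbit.hvec (σ s)) (fun s x => CrossedShearOrbit.fK_add_hvec x (σ s)) hν u₀

/-- The same with the force spelled as in the route items 33307 / 27440 / 33798. [folklore] -/
theorem galilean_vfieldT_not_isGlobalLerayHopf_stokesMode (ht : t ≠ 0) {ν : ℝ} (hν : 0 < ν)
    (m' : ℝ → EuclideanSpace ℝ (Fin 3)) (σ : ℝ → UnitAddTorus (Fin 2))
    (u₀ : UnitAddTorus (Fin 3) → EuclideanSpace ℝ (Fin 3)) :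
    ¬ Torus.IsGlobalLerayHopf ν
      (fun _ => ⇑(Literature.Analysis.FluidPDE.Torus.stokesMode (![0, 2, 0] : Fin 3 → ℤ)
        (EuclideanSpace.single (0 : Fin 3) (1 : ℝ)) false)) u₀
      (fun s x => m' s + vfieldT t (x + CrossedShearOrbit.hvec (σ s))) :=
  galilean_vfieldT_not_isGlobalLerayHopf ht hν m' σ u₀

end Summit.AnomalousDissipation.AnomalousDissipation.Theorems.CrossedShearRoot

end
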